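import Literature.Algebra.EuclideanLattices.KhotReductionSpec
import Literature.Algebra.EuclideanLattices.KhotNPHardness
import HarnessLib

/-!
# Khot 2005, Thm. 1.1 (constant factors, `p = 2`): the randomised reduction assembled — from gap set cover to `GapSVP`, modulo the machine

Topic `Algebra/EuclideanLattices`, namespace `Literature.Algebra.EuclideanLattices.Khot` (sub-namespace
`Params` for parameters). This file closes the PROBABILISTIC part of the decomposition of the named
fact `Literature.Algebra.EuclideanLattices.gapSVP_const_isNPHardRandomized` (`LatticeComplexity.lean`,
pqc.S17) begun in `KhotSVPHardness.lean` and carried through `KhotTensorBoost`, `KhotBasicReduction`,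
`KhotGapInstance`, `KhotRandomSublattice`, `KhotRecoverable`, `KhotCounting`, `KhotCardinality`,
`KhotAssembly`, `KhotParameters` (mathematics), `KhotGapInstancesParam` (the gap-instance theorem for
given data; the two sides of `gapSetCover 40`) and `KhotNPHardness` / `SatUnsatPromiseHard`
(complexity-theoretic glue: the target fact follows from `AroraEtAl1997_prop6` and ONE randomised
reduction `gapSetCover 40 → GapSVP_{γ₀}` per `γ₀ ≥ 1`, `gapSVP_const_isNPHardRandomized_of_gapSetCover_forty`).
It constructs that randomised reduction from an `FP` implementation of ONE explicit total map:

* **a power-of-two modulus** (`Params.q₂ = 2^{⌊log₂ q⌋+1}`, between `q` and `2q`): the main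
  sampling inequality of `KhotParameters.lean` has a spare factor `2` (`main_ineq₄`), so Khot's
  random sub-lattice (§5.2.2) may use the modulus `q₂` — then the row vector `r ∈ (ℤ/q₂)^{rows}` is
  sampled EXACTLY by reading `log₂ q₂` coins per entry (the printed prime `q` is not needed for
  `p = 2`: Lemmas 5.6–5.8 hold for every modulus, `KhotRandomSublattice.lean`; the alternative —
  modulus `q` and nearly uniform residues, `ResidueSampling.lean` — costs a factor `2` in the error
  instead);
* **the gap-instance theorem with bundled external data** (`khot_gap_instances₂`): the YES/NO
  counting bounds for the modulus `q₂`, any `k` with `8γ₀² < (8/7)^k`, and any admissible data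
  `Δ : KhotData k` — `0/1` matrices with `40K`-wise independent columns (Thm. 4.1) and bijections of
  the output index types with `Fin N_f` for all sizes (inhabited: `nonempty_khotData`); the proof is
  that of `khot_gap_instances` / `khot_gap_instances_of` with `q₂` for `q`;
* **the total output map** `khotOutput k Δ I c` on set cover instances `I` and coin strings `c`
  (guard `Guard I`: `1 ≤ K ≤ m`, `u ≥ 1`, the union of the sets covers the universe — otherwise the
  fixed YES instance `([1], 1)` when `u = 0 ∧ 1 ≤ K ≤ m` and the fixed NO instance `fixedNoPow k = ([1], 1/2^{k+1})`
  else; coins decoded in little-endian blocks: `31K` blocks of `log₂ N` bits for the tuple of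
  columns, then one block of `log₂ q₂` bits per row for `r`), the decoding being a BIJECTION between
  `{0,1}^{L₀}` and Khot's sample space `Ω = (Fin N)^{31K} × (ℤ/q₂)^{rows}` (`coinDecode_bijective`);
* **the probability bookkeeping** (`uniformProb_khotOutput_yes/no`): over uniform coins of any
  length `≥ L₀` the output is a YES (resp. NO) instance of `GapSVP_{γ₀}` with probability `≥ 2/3`
  on YES (resp. NO) instances of `gapSetCover 40` (prefixes of uniform strings are uniform,
  `map_take_uniformOfFintype_vector`; counting through the bijection; `1 - 2/100 ≥ 2/3`);
* **the final assembly** (`promiseRandReducible_gapSetCover_gapSVP_of_FP`,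
  `gapSVP_const_isNPHardRandomized_of_prop6_of_FP`): `gapSVP_const_isNPHardRandomized` follows from
  `AroraEtAl1997_prop6` and the IMPLEMENTATION STATEMENT that for every `k` some `F ∈ FP` computes
  `⟨code I, c⟩ ↦ code (khotOutput k Δ I c)` for some admissible `Δ`, with polynomially many coins —
  Khot's "the reduction runs in time `n^{O(k²)}`" (§7.3), the one remaining machine-level (TM2)
  obligation, kept here as an explicit HYPOTHESIS (no named fact is introduced).

## The remaining machine-level obligation (the hypothesis `h₂` of the final theorem), precisely

For each `k : ℕ`: admissible data `Δ : KhotData k` (any `0/1` matrices `P u σ K` of the stated shape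
with `40K`-wise `GF(2)`-independent columns — e.g. BCH parity matrices over any explicit
presentation of `GF(2^{M+1})` — and any bijections `eR`, `eC` fixing the order of rows and
columns of the output), an `F ∈ FP` and a polynomial `Q` such that for EVERY instance
`I : SetCoverInstance` and EVERY bit string `c`,
`F (boolPair (SetCoverInstance.encoding.encode I) c) = GapSVPInstance.encode (khotOutput k Δ I c)`
(input: the `tupleEncoding` code `⟨|U|, ⟨[S_j]_j, K⟩⟩` of `GapSetCover.lean` paired with the
coins; output: `gapSVPInstanceEncoding`, i.e. dimension header, row-major integer entries, reduced
rational threshold), and `L₀ u σ K k ≤ Q(|code I|)` whenever `Guard I`. Coin layout: bit `j` of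
column `g_i` (`i < 31K`) is coin `i·M + j`; bit `j` of `r_ρ` is coin `31K·M + (idxR ρ)·log₂ q₂ + j`
(`idxR`: universe, sets, BCH rows `(a, b) ↦ b + (M+1)a`, columns); missing coins read as absent
(shorter blocks), surplus coins are ignored. On the guard `u, K, σ ≤ |code I|` and every dimension
(`N = 2^{2M'}`, `rows`, `Nf`, the bit size of `q₂`, `D`, `Kpad`) is polynomial in `|code I|` for
fixed `k` (all exponents in `M'` are `O(k)`; §7.3: "runs in time `n^{O(k²)}`"), so the statement is
the printed running-time claim for this explicit map; off the guard the output is a constant.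

## Faithfulness notes

* The printed reduction starts from SAT through Thm. 3.1, whose input is the gap exact set cover
  instance of Bellare–Goldwasser–Lund–Russell / Arora–Babai–Stern–Sweedyk, Prop. 6 with `η = 1/40`
  (`gapSetCover 40`); composing with that Karp reduction is `PromiseRandReducible.of_isHard`
  (`PromiseRandReductions.lean`), so reducing from `gapSetCover 40` is reducing from SAT.
* Degenerate instances (`K = 0`, `K > m`, empty universe, an element in no set) are decided
  outright and sent to fixed instances; they are exactly the instances on which Khot's dimensions
  would not be polynomial in the code length (`K`, `u` are binary numerals) or `Fin u` is empty.
  The covering clause of `Guard` is what makes the machine hypothesis SATISFIABLE: an instance with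
  universe size `u` (a binary numeral) and few listed elements has `rows ≥ u`, exponential in
  `|code I|`, so no `FP` function can emit Khot's instance for it; with the clause, `u, K, σ ≤
  |code I|` on the guard (each listed element and each set costs `≥ 2` bits of the `listBool`
  code). (The sibling specification theorem `promiseRandReducible_gapSetCover_gapSVP_of_spec` of
  `KhotReductionSpec.lean` — modulus `q`, nearly uniform residues — asks its machine for Khot's
  instance on ALL instances with `1 ≤ K ≤ σ`, `u ≥ 1`; a machine meeting it must therefore first
  be composed with a guard of this kind.)
* Two-sided error `≤ 2/100 < 1/3` as printed (Thm. 5.1: "with probability at least 9/10" on each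
  side; here `98/100` and `99/100`).

## References

* S. Khot, *Hardness of approximating the shortest vector problem in lattices*, J. ACM 52 (2005)
  789–808: Thm. 1.1, Thm. 3.1, Thm. 4.1, Thm. 5.1, §5.2.2, §7.3.
* S. Arora, L. Babai, J. Stern, Z. Sweedyk, J. Comput. Syst. Sci. 54 (1997) 317–331, Prop. 6.
* S. Arora, B. Barak, *Computational Complexity: A Modern Approach*, CUP 2009, Lemma 2.11
  (Cook–Levin), Def. 7.3 and §7.6 (randomised reductions).
-/

noncomputable section

open Computability Literature.Computability.Complexity Literature.Computability.MetaComplexity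
  Literature.Computability.Complexity.PromiseProblem Literature.Algebra.EuclideanLattices

/-! ### A power-of-two modulus -/

namespace Literature.Algebra.EuclideanLattices.Khot

open Matrix Finset

namespace Params

variable (u σ K k : ℕ)

/-- `log₂` of the power-of-two modulus: `⌊log₂ q⌋ + 1`. [cite: Khot2005, §5.2.2] -/
def lq : ℕ := Nat.log 2 (qq u σ K k) + 1

/-- The power-of-two modulus `q₂ = 2^{⌊log₂ q⌋+1}` (`q < q₂ ≤ 2q`). [cite: Khot2005, §5.2.2] -/
def q₂ : ℕ := 2 ^ lq u σ K k

/-- `q < q₂`. [folklore] -/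
theorem qq_lt_q₂ : qq u σ K k < q₂ u σ K k := Nat.lt_pow_succ_log_self (by norm_num) _

/-- `q₂ ≤ 2q`. [folklore] -/
theorem q₂_le : q₂ u σ K k ≤ 2 * qq u σ K k := by
  unfold q₂ lq
  rw [pow_succ']
  exact Nat.mul_le_mul_left 2 (Nat.pow_log_le_self 2 (by unfold qq; omega))

/-- `1 ≤ q₂`. [folklore] -/
theorem one_le_q₂ : 1 ≤ q₂ u σ K k := Nat.one_le_two_pow

/-- `q₂ ≠ 0` (for `ZMod q₂`). [folklore] -/
instance neZero_q₂ : NeZero (q₂ u σ K k) := ⟨Nat.one_le_iff_ne_zero.1 (one_le_q₂ u σ K k)⟩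

/-- `B'` for the modulus `q₂`. [cite: Khot2005, Thm. 5.1 (2)] -/
def B₂ : ℕ := 100 * q₂ u σ K k * (31 * K) ^ (31 * K)

/-- `B₂ ≤ 2 B'`. [folklore] -/
theorem B₂_le : B₂ u σ K k ≤ 2 * B' u σ K k := by
  unfold B₂ B'
  have := q₂_le u σ K k
  calc 100 * q₂ u σ K k * (31 * K) ^ (31 * K) ≤ 100 * (2 * qq u σ K k) * (31 * K) ^ (31 * K) := by gcongr
    _ = 2 * (100 * qq u σ K k * (31 * K) ^ (31 * K)) := by ring

/-- `stepB` with the spare factor: `400·2^h·B' ≤ 2^(…)·(2·Pexpr)`. [folklore] -/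
theorem stepB₂ (hK : 1 ≤ K) :
    400 * 2 ^ hh u σ K k * B' u σ K k ≤ 2 ^ (40 * K * M' u σ K k + 2 * M' u σ K k * L K) * (2 * Pexpr u σ K k) := by
  have h := stepB u σ K k hK
  calc 400 * 2 ^ hh u σ K k * B' u σ K k = 2 * (200 * 2 ^ hh u σ K k * B' u σ K k) := by ring
    _ ≤ 2 * (2 ^ (40 * K * M' u σ K k + 2 * M' u σ K k * L K) * Pexpr u σ K k) := Nat.mul_le_mul_left 2 h
    _ = 2 ^ (40 * K * M' u σ K k + 2 * M' u σ K k * L K) * (2 * Pexpr u σ K k) := by ring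

/-- `stepC` with the spare factor: `2·Pexpr ≤ A·(M'+1)^(10K(k+1))` (the constant of `A` is `2·10⁸`,
that of `Pexpr` is `2·10⁷`). [folklore] -/
theorem stepC₂ (hK : 1 ≤ K) : 2 * Pexpr u σ K k ≤ A u σ K k * (M' u σ K k + 1) ^ (10 * K * (k + 1)) := by
  unfold Pexpr A
  set M := M' u σ K k
  have hR1 := one_le_R u σ K k
  have hRL : R u σ K k ^ L K ≤ (u + σ + 40 * K + 1) ^ (10 * K) * (M + 1) ^ (10 * K) := by
    rw [← mul_pow, ← L_succ K hK]
    exact Nat.pow_le_pow_right hR1 (Nat.le_succ _)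
  have h2L : 2 ^ L K ≤ 2 ^ (10 * K) := Nat.pow_le_pow_right (by norm_num) (by rw [← L_succ K hK]; omega)
  have hDL : DD u σ K k ^ (L K + 1) ≤ D₀ K k ^ (10 * K) * (M + 1) ^ (10 * K * k) := by
    rw [L_succ K hK]
    calc DD u σ K k ^ (10 * K) ≤ (D₀ K k * (M + 1) ^ k) ^ (10 * K) := Nat.pow_le_pow_left (DD_le u σ K k hK) _
      _ = D₀ K k ^ (10 * K) * (M + 1) ^ (10 * K * k) := by rw [mul_pow, ← pow_mul]; ring_nf
  set X := 2 ^ (20 * K) * (31 * K) ^ (31 * K) with hX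
  set Y := (u + σ + 40 * K + 1) ^ (10 * K) with hY
  set Z := D₀ K k ^ (10 * K) with hZ
  calc 2 * (2 * 10 ^ 7 * K * 2 ^ (20 * K) * (31 * K) ^ (31 * K) * R u σ K k ^ L K * 2 ^ L K * DD u σ K k ^ (L K + 1))
      = 4 * 10 ^ 7 * K * X * R u σ K k ^ L K * 2 ^ L K * DD u σ K k ^ (L K + 1) := by rw [hX]; ring
    _ ≤ 4 * 10 ^ 7 * K * X * (Y * (M + 1) ^ (10 * K)) * 2 ^ (10 * K) * (Z * (M + 1) ^ (10 * K * k)) := by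
        gcongr
    _ = 4 * 10 ^ 7 * (K * X * Y * 2 ^ (10 * K) * Z * (M + 1) ^ (10 * K * (k + 1))) := by
        rw [show 10 * K * (k + 1) = 10 * K + 10 * K * k by ring, pow_add]; ring
    _ ≤ 2 * 10 ^ 8 * (K * X * Y * 2 ^ (10 * K) * Z * (M + 1) ^ (10 * K * (k + 1))) :=
        Nat.mul_le_mul_right _ (by norm_num)
    _ = 2 * 10 ^ 8 * K * 2 ^ (20 * K) * (31 * K) ^ (31 * K) * (u + σ + 40 * K + 1) ^ (10 * K) *
          2 ^ (10 * K) * D₀ K k ^ (10 * K) * (M + 1) ^ (10 * K * (k + 1)) := by rw [hX, hY, hZ]; ring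

/-- The main sampling inequality with the spare factor: `400 · 2^h · B' ≤ N^(31K)`. [folklore] -/
theorem main_ineq₄ (hK : 1 ≤ K) : 400 * 2 ^ hh u σ K k * B' u σ K k ≤ NN u σ K k ^ (31 * K) :=
  calc 400 * 2 ^ hh u σ K k * B' u σ K k
      ≤ 2 ^ (40 * K * M' u σ K k + 2 * M' u σ K k * L K) * (2 * Pexpr u σ K k) := stepB₂ u σ K k hK
    _ ≤ 2 ^ (40 * K * M' u σ K k + 2 * M' u σ K k * L K) * (A u σ K k * (M' u σ K k + 1) ^ (10 * K * (k + 1))) :=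
        Nat.mul_le_mul_left _ (stepC₂ u σ K k hK)
    _ ≤ 2 ^ (40 * K * M' u σ K k + 2 * M' u σ K k * L K) * 2 ^ (M' u σ K k * (K + 1) + M' u σ K k * K) :=
        Nat.mul_le_mul_left _ (stepD u σ K k)
    _ ≤ NN u σ K k ^ (31 * K) := stepE u σ K k hK

/-- First sampling condition for the modulus `q₂`. [folklore] -/
theorem hS1₂_of (hK : 1 ≤ K) {C : ℕ} (hC : C ≤ (31 * K) ^ 2 * NN u σ K k ^ (31 * K - 1)) :
    100 * (C + 2 ^ hh u σ K k * B₂ u σ K k) ≤ NN u σ K k ^ (31 * K) := by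
  have h1 : 200 * C ≤ NN u σ K k ^ (31 * K) := by
    have hN := lt_NN u σ K k
    calc 200 * C ≤ 200 * ((31 * K) ^ 2 * NN u σ K k ^ (31 * K - 1)) := Nat.mul_le_mul_left _ hC
      _ = (200 * (31 * K) ^ 2) * NN u σ K k ^ (31 * K - 1) := by ring
      _ ≤ NN u σ K k * NN u σ K k ^ (31 * K - 1) := Nat.mul_le_mul_right _ hN.le
      _ = NN u σ K k ^ (31 * K) := by rw [← pow_succ']; congr 1; omega
  have h2 := main_ineq₄ u σ K k hK
  have h4 : 100 * (2 ^ hh u σ K k * B₂ u σ K k) ≤ 200 * 2 ^ hh u σ K k * B' u σ K k :=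
    calc 100 * (2 ^ hh u σ K k * B₂ u σ K k) ≤ 100 * (2 ^ hh u σ K k * (2 * B' u σ K k)) := by
          gcongr; exact B₂_le u σ K k
      _ = 200 * 2 ^ hh u σ K k * B' u σ K k := by ring
  rw [Nat.mul_add]
  linarith

end Params

/-! ### The gap-instance theorem with external data -/

section Data

open Params

/-- **The data a machine has to supply** for `k` levels: for all sizes `u, σ, K`, a `0/1` matrix
`P` with `20K · (M+1)` rows and `N` columns whose columns are `40K`-wise independent over `GF(2)`
(Khot's `P_BCH`, Thm. 4.1; one exists by `exists_bch01Matrix`), the common size `Nf` of the output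
matrix and bijections of its row and column index types with `Fin Nf` (the order in which the
machine writes the entries). [cite: Khot2005, Thm. 4.1 and §7.3] -/
structure KhotData (k : ℕ) where
  /-- the BCH-type parity matrices -/
  P : ∀ u σ K : ℕ, Matrix (Fin (20 * K) × Fin (MM u σ K k + 1)) (Fin (NN u σ K k)) ℤ
  /-- entries are `0/1` -/
  P01 : ∀ u σ K rr i, P u σ K rr i = 0 ∨ P u σ K rr i = 1
  /-- any `40K` columns are independent over `GF(2)` -/
  dwise : ∀ u σ K, DWise (P u σ K) (40 * K)
  /-- the output dimension -/
  Nf : ℕ → ℕ → ℕ → ℕ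
  /-- the row order -/
  eR : ∀ u σ K, Out (RowsT u σ K k ⊕ Unit) (ColsT u σ K k) k ≃ Fin (Nf u σ K)
  /-- the column order (`e₀ = 0 ∈ Fin u` needs `u ≥ 1`) -/
  eC : ∀ u σ K (hu : 1 ≤ u), (Coef (ColsT u σ K k) k ⊕ {o // augPad (n := ColsT u σ K k)
    (basePad (S := Fin σ) (H := Fin (20 * K) × Fin (MM u σ K k + 1)) (Nn := Fin (NN u σ K k)) (⟨0, hu⟩ : Fin u)) k o}) ≃
      Fin (Nf u σ K)

/-- **Admissible data exist** (BCH matrices by `exists_bch01Matrix`, orders by counting,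
`KhotCardinality`). [cite: Khot2005, Thm. 4.1] -/
theorem nonempty_khotData (k : ℕ) : Nonempty (KhotData k) := by
  classical
  have hP : ∀ u σ K : ℕ, ∃ P : Matrix (Fin (20 * K) × Fin (MM u σ K k + 1)) (Fin (NN u σ K k)) ℤ,
      (∀ rr i, P rr i = 0 ∨ P rr i = 1) ∧ DWise P (40 * K) := fun u σ K => by
    obtain ⟨P, hP01, hPdw⟩ := Literature.InformationTheory.Coding.exists_bch01Matrix (20 * K) (MM u σ K k + 1)
      (NN u σ K k) (by omega) (by unfold NN; rw [pow_succ]; have := Nat.one_le_two_pow (n := MM u σ K k); omega)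
    exact ⟨P, hP01, fun z hz hcard => hPdw z hz (by omega)⟩
  choose P hP01 hDW using hP
  let Nf : ℕ → ℕ → ℕ → ℕ := fun u σ K => Fintype.card (Out (RowsT u σ K k ⊕ Unit) (ColsT u σ K k) k)
  have hcard : ∀ u σ K (hu : 1 ≤ u), Fintype.card (Coef (ColsT u σ K k) k ⊕ {o // augPad (n := ColsT u σ K k)
      (basePad (S := Fin σ) (H := Fin (20 * K) × Fin (MM u σ K k + 1)) (Nn := Fin (NN u σ K k)) (⟨0, hu⟩ : Fin u)) k o}) =
        Nf u σ K := fun u σ K hu => by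
    rw [Fintype.card_sum]
    exact card_coef_add_card_augPad (n := ColsT u σ K k) _ (card_base_cols_add_card_basePad (S := Fin σ)
      (H := Fin (20 * K) × Fin (MM u σ K k + 1)) (Nn := Fin (NN u σ K k)) (⟨0, hu⟩ : Fin u)) k
  exact ⟨KhotData.mk P hP01 hDW Nf (fun u σ K => Fintype.equivFin _)
    (fun u σ K hu => Fintype.equivFinOfCardEq (hcard u σ K hu))⟩

open Classical in
/-- **Khot 2005, Thm. 1.1 (first assertion, `p = 2`), counting form with external data and the
power-of-two modulus.** For `γ₀ ≥ 1` and `k` with `8γ₀² < (8/7)^k`, for every set system `F` on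
`Fin u` (`u ≥ 1`) with `σ` sets, every `K ≥ 1` and every admissible data `Δ`, over
`Ω = (Fin N)^{31K} × (ℤ/q₂)^{rows}`: (YES) an exact cover by `K` sets ⇒ at most `2/100` of `Ω`
gives an instance outside `GapSVP.yes`; (NO) no `< 40K` sets cover ⇒ at most `1/100` of `Ω` gives
an instance outside `GapSVP.no γ₀`. [cite: Khot2005, Thm. 1.1, Thm. 5.1 and §7.3] -/
theorem khot_gap_instances₂ {γ₀ : ℝ} (hγ₀ : 1 ≤ γ₀) {k : ℕ} (hk : 8 * γ₀ ^ 2 < (8 / 7 : ℝ) ^ k)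
    (Δ : KhotData k) (u σ K : ℕ) (hu : 1 ≤ u) (hK : 1 ≤ K) (F : Fin σ → Finset (Fin u)) :
    ((∃ T₀ : Finset (Fin σ), T₀.card = K ∧ ∀ e : Fin u, (T₀.filter fun j => e ∈ F j).card = 1) →
      100 * #((univ : Finset ((Fin (31 * K) → Fin (NN u σ K k)) × (RowsT u σ K k → ZMod (q₂ u σ K k)))).filter
          fun ω => khotInstance (DD u σ K k : ℤ) F (Δ.P u σ K) (tupleShift (Δ.P u σ K) ω.1) (DD u σ K k : ℤ) (q₂ u σ K k)
            (⟨0, hu⟩ : Fin u) ((ss u σ K k ^ k : ℕ) : ℤ) k (DD u σ K k : ℤ) (tauN u σ K k : ℚ) (Δ.eR u σ K) (Δ.eC u σ K hu) ω.2 ∉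
              GapSVP.yes fun _ => γ₀) ≤
        2 * (Fintype.card (Fin (NN u σ K k)) ^ (31 * K) * q₂ u σ K k ^ Fintype.card (RowsT u σ K k))) ∧
    ((∀ T₀ : Finset (Fin σ), T₀.card < 40 * K → ∃ e : Fin u, ∀ j ∈ T₀, e ∉ F j) →
      100 * #((univ : Finset ((Fin (31 * K) → Fin (NN u σ K k)) × (RowsT u σ K k → ZMod (q₂ u σ K k)))).filter
          fun ω => khotInstance (DD u σ K k : ℤ) F (Δ.P u σ K) (tupleShift (Δ.P u σ K) ω.1) (DD u σ K k : ℤ) (q₂ u σ K k)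
            (⟨0, hu⟩ : Fin u) ((ss u σ K k ^ k : ℕ) : ℤ) k (DD u σ K k : ℤ) (tauN u σ K k : ℚ) (Δ.eR u σ K) (Δ.eC u σ K hu) ω.2 ∉
              GapSVP.no fun _ => γ₀) ≤
        Fintype.card (Fin (NN u σ K k)) ^ (31 * K) * q₂ u σ K k ^ Fintype.card (RowsT u σ K k)) := by
  classical
  have hrowsne : 0 < Fintype.card (RowsT u σ K k) :=
    Fintype.card_pos_iff.2 ⟨Sum.inl (Sum.inl ⟨0, hu⟩)⟩
  set P := Δ.P u σ K
  have hP01 : ∀ rr i, P rr i = 0 ∨ P rr i = 1 := Δ.P01 u σ K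
  have hDW : DWise P (40 * K) := Δ.dwise u σ K
  set e₀ : Fin u := ⟨0, hu⟩
  set eR := Δ.eR u σ K
  set eC := Δ.eC u σ K hu
  have hlevel : Fintype.card (Coef (ColsT u σ K k) k ⊕ {o // augPad (n := ColsT u σ K k)
      (basePad (S := Fin σ) (H := Fin (20 * K) × Fin (MM u σ K k + 1)) (Nn := Fin (NN u σ K k)) e₀) k o}) =
        Δ.Nf u σ K := Fintype.card_fin (Δ.Nf u σ K) ▸ Fintype.card_congr eC
  refine ⟨?_, ?_⟩
  · -- YES
    rintro ⟨T₀, hTK, hTex⟩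
    have hT₀ := cvpBasis_indicator_sub_target (DD u σ K k : ℤ) F T₀ hTex
    have hQ : (1 : ℤ) ≤ (DD u σ K k : ℤ) := by exact_mod_cast one_le_DD u σ K k hK
    have hS1 : 100 * (#((univ : Finset (Fin (31 * K) → Fin (NN u σ K k))).filter fun g => ¬Function.Injective g) +
        2 ^ Fintype.card (Fin (20 * K) × Fin (MM u σ K k + 1)) * B₂ u σ K k) ≤ Fintype.card (Fin (NN u σ K k)) ^ (31 * K) := by
      rw [Fintype.card_prod, Fintype.card_fin, Fintype.card_fin, Fintype.card_fin,
        show 20 * K * (MM u σ K k + 1) = hh u σ K k from rfl]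
      refine hS1₂_of u σ K k hK ?_
      have h := card_not_injective_le (α := Fin (NN u σ K k)) (31 * K)
      rw [Fintype.card_fin] at h
      exact h.trans (le_of_eq (by ring))
    have hs1 := one_le_ss u σ K k
    have hsW : (((ss u σ K k : ℕ) : ℤ)) ^ k ≤ (((ss u σ K k ^ k : ℕ) : ℤ)) ^ 2 := by
      rw [Nat.cast_pow, ← pow_mul]
      exact pow_le_pow_right₀ (by exact_mod_cast hs1) (by omega)
    have hle : (((2 * ((ss u σ K k ^ k : ℕ) : ℤ) ^ 2 * (35 * K : ℤ) ^ (k + 1) : ℤ)) : ℝ) ≤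
        ((tauN u σ K k : ℚ) : ℝ) ^ 2 := by
      have h1 := (XX_lt_tau_sq u σ K k).le
      have h2 : ((2 * ((ss u σ K k ^ k : ℕ) : ℤ) ^ 2 * (35 * K : ℤ) ^ (k + 1) : ℤ)) = (XX u σ K k : ℤ) := by
        unfold XX; push_cast; ring
      rw [h2, Rat.cast_natCast]
      exact_mod_cast h1
    have h := card_bad_yes_total_le (q := q₂ u σ K k) (U := Fin u) (S := Fin σ)
      (H := Fin (20 * K) × Fin (MM u σ K k + 1)) (Nn := Fin (NN u σ K k)) hQ hP01 hT₀
      (rr := 31 * K) (by omega) (B' := B₂ u σ K k) hS1 (le_of_eq (by unfold B₂; rfl))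
      hQ e₀ (W := ((ss u σ K k ^ k : ℕ) : ℤ)) (by exact_mod_cast Nat.one_le_pow _ _ hs1) k
      (g₀ := (35 * K : ℤ)) (s := (ss u σ K k : ℤ)) (by rw [hTK]; push_cast; ring) (by
        have : (1 : ℤ) ≤ K := by exact_mod_cast hK
        linarith)
      (by
        rw [hTK, Fintype.card_prod, Fintype.card_fin, Fintype.card_fin]
        unfold ss hh
        push_cast; ring)
      hsW (T := (DD u σ K k : ℤ)) (by positivity) eR eC (fun _ => γ₀) (τ := (tauN u σ K k : ℚ))
      (by unfold tauN; positivity) hle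
    exact h
  · -- NO
    intro hNO
    have hD1 := one_le_DD u σ K k hK
    have hQ : (1 : ℤ) ≤ (DD u σ K k : ℤ) := by exact_mod_cast hD1
    have hs1 := one_le_ss u σ K k
    have hq : ∀ g : Fin (31 * K) → Fin (NN u σ K k),
        100 * #(annoyingVectors (intBasis (DD u σ K k : ℤ) F P (tupleShift P g)) (40 * K) (DD u σ K k)) *
          DD u σ K k ≤ q₂ u σ K k := by
      intro g
      have hA := card_annoyingVectors_intBasis_le (Q := (DD u σ K k : ℤ)) (by positivity) F hNO hDW le_rfl
        hD1 (tupleShift P g) hrowsne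
      rw [card_RowsT] at hA
      refine le_trans ?_ (qq_lt_q₂ u σ K k).le
      rw [qq_eq u σ K k hK]
      unfold Abound
      exact Nat.mul_le_mul_right _ (Nat.mul_le_mul_left 100 hA)
    have hDk : (((ss u σ K k ^ k : ℕ) : ℤ)) ^ 2 * ((40 * K : ℕ) : ℤ) ^ (k + 1) ≤ ((DD u σ K k : ℕ) : ℤ) ^ 2 := by
      have e : ((DD u σ K k : ℕ) : ℤ) = ((ss u σ K k ^ k : ℕ) : ℤ) * ((40 * K : ℕ) : ℤ) ^ (k + 1) := by
        unfold DD; push_cast; ring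
      rw [e, mul_pow]
      refine mul_le_mul_of_nonneg_left ?_ (sq_nonneg _)
      have h1 : (1 : ℤ) ≤ ((40 * K : ℕ) : ℤ) ^ (k + 1) := one_le_pow₀ (by exact_mod_cast (show 1 ≤ 40 * K by omega))
      exact le_self_pow₀ h1 two_ne_zero
    have hbT : (((ss u σ K k ^ k : ℕ) : ℤ)) ^ 2 * ((40 * K : ℕ) : ℤ) ^ (k + 1) ≤ ((DD u σ K k : ℤ) + 1) ^ 2 :=
      hDk.trans (by nlinarith)
    have hlt : (γ₀ * ((tauN u σ K k : ℚ) : ℝ)) ^ 2 <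
        (((((ss u σ K k ^ k : ℕ) : ℤ)) ^ 2 * ((40 * K : ℕ) : ℤ) ^ (k + 1) : ℤ) : ℝ) := by
      have h1 : ((tauN u σ K k : ℚ) : ℝ) ^ 2 ≤ 4 * (XX u σ K k : ℝ) := by
        rw [Rat.cast_natCast]; exact_mod_cast tau_sq_le u σ K k hK
      have hk' : 8 * γ₀ ^ 2 < (8 / 7 : ℝ) ^ (k + 1) :=
        hk.trans_le (pow_le_pow_right₀ (by norm_num) (Nat.le_succ k))
      have hXX : (XX u σ K k : ℝ) = 2 * ((ss u σ K k : ℝ) ^ k) ^ 2 * (35 * K) ^ (k + 1) := by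
        unfold XX; push_cast; ring
      have hpos : (0 : ℝ) < ((ss u σ K k : ℝ) ^ k) ^ 2 * (35 * K) ^ (k + 1) := by
        have : (1 : ℝ) ≤ ss u σ K k := by exact_mod_cast hs1
        have : (1 : ℝ) ≤ K := by exact_mod_cast hK
        positivity
      have htarget : (((((ss u σ K k ^ k : ℕ) : ℤ)) ^ 2 * ((40 * K : ℕ) : ℤ) ^ (k + 1) : ℤ) : ℝ) =
          ((ss u σ K k : ℝ) ^ k) ^ 2 * ((8 / 7 : ℝ) ^ (k + 1) * (35 * K) ^ (k + 1)) := by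
        have e : (8 / 7 : ℝ) ^ (k + 1) * (35 * (K : ℝ)) ^ (k + 1) = (40 * (K : ℝ)) ^ (k + 1) := by
          rw [← mul_pow]; congr 1; ring
        rw [e]; push_cast; ring
      rw [htarget]
      calc (γ₀ * ((tauN u σ K k : ℚ) : ℝ)) ^ 2 = γ₀ ^ 2 * ((tauN u σ K k : ℚ) : ℝ) ^ 2 := by ring
        _ ≤ γ₀ ^ 2 * (4 * (XX u σ K k : ℝ)) := mul_le_mul_of_nonneg_left h1 (by positivity)
        _ = 8 * γ₀ ^ 2 * (((ss u σ K k : ℝ) ^ k) ^ 2 * (35 * K) ^ (k + 1)) := by rw [hXX]; ring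
        _ < (8 / 7 : ℝ) ^ (k + 1) * (((ss u σ K k : ℝ) ^ k) ^ 2 * (35 * K) ^ (k + 1)) :=
            mul_lt_mul_of_pos_right hk' hpos
        _ = ((ss u σ K k : ℝ) ^ k) ^ 2 * ((8 / 7 : ℝ) ^ (k + 1) * (35 * K) ^ (k + 1)) := by ring
    have hNf : 0 < Δ.Nf u σ K := by
      rw [← hlevel, Fintype.card_sum, card_coef]
      exact Nat.add_pos_left (pow_pos (Fintype.card_pos_iff.2 ⟨Sum.inr ()⟩) _) _
    have h := card_bad_no_total_le (q := q₂ u σ K k) (U := Fin u) (S := Fin σ)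
      (H := Fin (20 * K) × Fin (MM u σ K k + 1)) (Nn := Fin (NN u σ K k)) hQ F hP01 (31 * K)
      (d := 40 * K) (D := DD u σ K k) hD1 hq e₀ (W := ((ss u σ K k ^ k : ℕ) : ℤ))
      (by exact_mod_cast Nat.one_le_pow _ _ hs1) k hDk (T := (DD u σ K k : ℤ)) (by positivity) hbT hNf eR eC
      (γ := fun _ => γ₀) (by linarith) (τ := (tauN u σ K k : ℚ)) (by unfold tauN; positivity) hlt
    exact h

end Data


/-! ### Coins: little-endian blocks -/

section Bits

/-- Block `i` of width `w` of a bit list: the bits at positions `i·w, …, i·w + w - 1` (shorter or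
empty past the end of the list). [folklore] -/
def block (w : ℕ) (c : List Bool) (i : ℕ) : List Bool := (c.drop (i * w)).take w

/-- A block has at most `w` bits. (Same statement as `LearnerDistinguisher.length_block_le` of
`Computability/Learning/CryptoHardnessMachine.lean` for that file's own `block`; that module is not
in the import closure of the lattice files — checked: its namespace is unknown here.) [folklore] -/
theorem length_block_le (w : ℕ) (c : List Bool) (i : ℕ) : (block w c i).length ≤ w := List.length_take_le _ _

/-- Blocks inside the list have exactly `w` bits. [folklore] -/
theorem length_block {w n : ℕ} {c : List Bool} (hc : n * w ≤ c.length) {i : ℕ} (hi : i < n) :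
    (block w c i).length = w := by
  unfold block
  rw [List.length_take, List.length_drop]
  have h : (i + 1) * w ≤ n * w := Nat.mul_le_mul_right w hi
  rw [Nat.add_mul, one_mul] at h
  omega

/-- The value of a block is `< 2^w`. [folklore] -/
theorem bitsToNat_block_lt (w : ℕ) (c : List Bool) (i : ℕ) : bitsToNat (block w c i) < 2 ^ w :=
  (bitsToNat_lt _).trans_le (Nat.pow_le_pow_right (by norm_num) (length_block_le w c i))

/-- Block `0` is the prefix of length `w`. [folklore] -/
theorem block_zero (w : ℕ) (c : List Bool) : block w c 0 = c.take w := by simp [block]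

/-- Block `i + 1` is block `i` of the list with its first `w` bits dropped. [folklore] -/
theorem block_succ (w : ℕ) (c : List Bool) (i : ℕ) : block w c (i + 1) = block w (c.drop w) i := by
  unfold block
  rw [List.drop_drop]
  congr 2
  ring

/-- A list of length `n·w` is determined by its first `n` blocks of width `w`. [folklore] -/
theorem eq_of_block_eq {w : ℕ} : ∀ {n : ℕ} {c c' : List Bool}, c.length = n * w → c'.length = n * w →
    (∀ i < n, block w c i = block w c' i) → c = c'
  | 0, c, c', hc, hc', _ => by
    rw [Nat.zero_mul] at hc hc'
    rw [List.eq_nil_of_length_eq_zero hc, List.eq_nil_of_length_eq_zero hc']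
  | n + 1, c, c', hc, hc', h => by
    rw [← List.take_append_drop w c, ← List.take_append_drop w c']
    have h0 := h 0 (Nat.succ_pos n)
    rw [block_zero, block_zero] at h0
    rw [h0]
    congr 1
    refine eq_of_block_eq (w := w) (n := n) ?_ ?_ fun i hi => ?_
    · rw [List.length_drop, hc, Nat.succ_mul]; omega
    · rw [List.length_drop, hc', Nat.succ_mul]; omega
    · have := h (i + 1) (by omega)
      rwa [block_succ, block_succ] at this

/-- Blocks inside a prefix are blocks of the list. [folklore] -/
theorem block_take {w L : ℕ} (c : List Bool) {i : ℕ} (h : (i + 1) * w ≤ L) : block w (c.take L) i = block w c i := by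
  unfold block
  rw [List.drop_take, List.take_take]
  congr 1
  rw [Nat.add_mul, one_mul] at h
  omega

end Bits

/-! ### Decoding the coins: Khot's sample space `Ω = (Fin N)^{31K} × (ℤ/q₂)^{rows}` -/

namespace Params

variable (u σ K k : ℕ)

/-- Number of coins for the tuple of `31K` columns (`log₂ N = M` bits each). [cite: Khot2005, Lemma 4.3 and §5.1] -/
def Lg : ℕ := 31 * K * MM u σ K k

/-- Total number of coins read: `31K · M + rows · log₂ q₂`. [cite: Khot2005, §5.2.2 and §7.3] -/
def L₀ : ℕ := Lg u σ K k + rows u σ K k * lq u σ K k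

end Params

section Coins

open Params

variable (u σ K k : ℕ)

/-- The tuple of columns read off the coins: column `i < 31K` is the little-endian value of block
`i` of width `M` (`< 2^M = N`). [cite: Khot2005, Lemma 4.3 ("choose a random set by picking …")] -/
def gOf (c : List Bool) : Fin (31 * K) → Fin (NN u σ K k) :=
  fun i => ⟨bitsToNat (block (MM u σ K k) c i), by unfold NN; exact bitsToNat_block_lt _ _ _⟩

/-- The fixed enumeration of the rows of the intermediate lattice: universe, sets, BCH rows
`(a, b) ↦ b + (M+1)·a` after them, then the `N` columns. [folklore] -/
def idxR : RowsT u σ K k ≃ Fin (rows u σ K k) :=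
  (Equiv.sumCongr finSumFinEquiv ((Equiv.sumCongr finProdFinEquiv (Equiv.refl _)).trans finSumFinEquiv)).trans
    (finSumFinEquiv.trans (finCongr (by unfold rows hh; ring)))

/-- The random row vector read off the coins: entry `ρ` is the little-endian value of block
`idxR ρ` of width `log₂ q₂` after the first `Lg` coins, in `ℤ/q₂` (exactly uniform, `q₂` being a
power of two). [cite: Khot2005, §5.2.2 ("each of which is chosen randomly from the range [0, q-1]")] -/
def rOf (c : List Bool) : RowsT u σ K k → ZMod (q₂ u σ K k) :=
  fun ρ => ((bitsToNat (block (lq u σ K k) (c.drop (Lg u σ K k)) (idxR u σ K k ρ)) : ℕ) : ZMod (q₂ u σ K k))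

/-- The decoded sample point `(g, r) ∈ Ω`. [cite: Khot2005, §5.2.2 and Lemma 4.3] -/
def coinDecode (c : List Bool) : (Fin (31 * K) → Fin (NN u σ K k)) × (RowsT u σ K k → ZMod (q₂ u σ K k)) :=
  (gOf u σ K k c, rOf u σ K k c)

/-- Only the first `L₀` coins are read. [folklore] -/
theorem coinDecode_take (c : List Bool) : coinDecode u σ K k (c.take (L₀ u σ K k)) = coinDecode u σ K k c := by
  unfold coinDecode
  refine Prod.ext ?_ ?_
  · funext i
    have hi : ((i : ℕ) + 1) * MM u σ K k ≤ 31 * K * MM u σ K k := Nat.mul_le_mul_right _ i.isLt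
    apply Fin.ext
    simp only [gOf]
    rw [block_take c (le_trans hi (by unfold L₀ Lg; omega))]
  · funext ρ
    have hj : ((idxR u σ K k ρ : ℕ) + 1) * lq u σ K k ≤ rows u σ K k * lq u σ K k :=
      Nat.mul_le_mul_right _ (idxR u σ K k ρ).isLt
    simp only [rOf]
    rw [List.drop_take, block_take _ (le_trans hj (by unfold L₀; omega))]

/-- Decoding is injective on coin strings of length `L₀`. [folklore] -/
theorem coinDecode_injective :
    Function.Injective fun r : List.Vector Bool (L₀ u σ K k) => coinDecode u σ K k r.toList := by
  rintro ⟨c, hc⟩ ⟨c', hc'⟩ h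
  have hg := congrArg Prod.fst h
  have hr := congrArg Prod.snd h
  apply List.Vector.toList_injective
  show c = c'
  simp only [List.Vector.toList_mk, coinDecode] at hg hr
  rw [← List.take_append_drop (Lg u σ K k) c, ← List.take_append_drop (Lg u σ K k) c']
  have hLg : Lg u σ K k ≤ L₀ u σ K k := Nat.le_add_right _ _
  congr 1
  · refine eq_of_block_eq (n := 31 * K) (w := MM u σ K k) (by rw [List.length_take, hc, min_eq_left hLg]; rfl)
      (by rw [List.length_take, hc', min_eq_left hLg]; rfl) fun i hi => ?_
    have h1 : (i + 1) * MM u σ K k ≤ Lg u σ K k := Nat.mul_le_mul_right _ hi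
    rw [block_take c h1, block_take c' h1]
    have hv := congrArg Fin.val (congrFun hg ⟨i, hi⟩)
    simp only [gOf] at hv
    refine Kannan.eq_of_bitsToNat_eq ?_ hv
    rw [length_block (n := 31 * K) (by rw [hc]; exact hLg) hi, length_block (n := 31 * K) (by rw [hc']; exact hLg) hi]
  · refine eq_of_block_eq (n := rows u σ K k) (w := lq u σ K k) (by rw [List.length_drop, hc]; unfold L₀; omega)
      (by rw [List.length_drop, hc']; unfold L₀; omega) fun j hj => ?_
    have hv := congrFun hr ((idxR u σ K k).symm ⟨j, hj⟩)
    simp only [rOf, Equiv.apply_symm_apply] at hv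
    have hq : ∀ l : List Bool, bitsToNat (block (lq u σ K k) l j) < q₂ u σ K k := fun l => by
      unfold q₂; exact bitsToNat_block_lt _ _ _
    rw [ZMod.natCast_eq_natCast_iff', Nat.mod_eq_of_lt (hq _), Nat.mod_eq_of_lt (hq _)] at hv
    refine Kannan.eq_of_bitsToNat_eq ?_ hv
    rw [length_block (n := rows u σ K k) (by rw [List.length_drop, hc]; unfold L₀; omega) hj,
      length_block (n := rows u σ K k) (by rw [List.length_drop, hc']; unfold L₀; omega) hj]

/-- `|Ω| = 2^{L₀}`. [folklore] -/
theorem card_Ω : Fintype.card (Fin (NN u σ K k)) ^ (31 * K) * q₂ u σ K k ^ Fintype.card (RowsT u σ K k) =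
    2 ^ L₀ u σ K k := by
  rw [Fintype.card_fin, card_RowsT]
  unfold NN q₂ L₀ Lg
  rw [← pow_mul, ← pow_mul, ← pow_add]
  congr 1; ring

/-- `|Ω| = 2^{L₀}`, as the cardinality of the product type. [folklore] -/
theorem card_Ω' : Fintype.card ((Fin (31 * K) → Fin (NN u σ K k)) × (RowsT u σ K k → ZMod (q₂ u σ K k))) =
    2 ^ L₀ u σ K k := by
  rw [Fintype.card_prod, Fintype.card_fun, Fintype.card_fun, Fintype.card_fin (31 * K), ZMod.card]
  exact card_Ω u σ K k

/-- Decoding is a bijection `{0,1}^{L₀} → Ω` (injective between sets of equal size): the coins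
sample `Ω` EXACTLY uniformly. [folklore] -/
theorem coinDecode_bijective :
    Function.Bijective fun r : List.Vector Bool (L₀ u σ K k) => coinDecode u σ K k r.toList :=
  (Fintype.bijective_iff_injective_and_card _).2
    ⟨coinDecode_injective u σ K k, by rw [card_vector, Fintype.card_bool, card_Ω']⟩

/-- Counting through the decoding: an event on `Ω` has as many coin strings as sample points.
[folklore] -/
theorem card_filter_coinDecode (p : (Fin (31 * K) → Fin (NN u σ K k)) × (RowsT u σ K k → ZMod (q₂ u σ K k)) → Prop)
    [DecidablePred p] :
    #((univ : Finset (List.Vector Bool (L₀ u σ K k))).filter fun r => p (coinDecode u σ K k r.toList)) =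
      #((univ : Finset _).filter p) :=
  Finset.card_bijective _ (coinDecode_bijective u σ K k) fun r => by simp

end Coins

/-! ### The total output map -/

section OutputMap

open Params

/-- The fixed NO instance `([1], 1/2^{k+1})` of `GapSVP_γ` for every `γ < 2^k` (it depends on the
number of levels `k` only, not on `γ₀` itself: `8γ₀² < (8/7)^k` gives `γ₀ < 2^k`; the fixed YES
instance `fixedYes = ([1], 1)` is the one of `KhotReductionSpec.lean`). [folklore] -/
def fixedNoPow (k : ℕ) : GapSVPInstance := (columnInstance (1 : Matrix (Fin 1) (Fin 1) ℤ), 1 / 2 ^ (k + 1))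

/-- The identity basis has independent columns. [folklore] -/
theorem one_mulVec_eq_zero (u : Fin 1 → ℤ) (hu : (1 : Matrix (Fin 1) (Fin 1) ℤ) *ᵥ u = 0) : u = 0 := by
  rwa [Matrix.one_mulVec] at hu

/-- `fixedNoPow k` is a NO instance of `GapSVP_{γ₀}` for `0 ≤ γ₀ < 2^k`. [folklore] -/
theorem fixedNoPow_mem {γ₀ : ℝ} (h0 : 0 ≤ γ₀) {k : ℕ} (hγ : γ₀ < 2 ^ k) : fixedNoPow k ∈ GapSVP.no fun _ => γ₀ := by
  refine columnInstance_mem_gapSVP_no (N := 1) Nat.one_pos one_mulVec_eq_zero (by positivity) (b := 1) ?_ h0 ?_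
  · intro u hu
    rw [Matrix.one_mulVec]
    have h1 : u 0 ≠ 0 := fun h => hu (funext fun i => by fin_cases i; exact h)
    unfold intSqNorm
    rw [Fin.sum_univ_one]
    exact (one_le_sq_iff_one_le_abs _).2 (Int.one_le_abs h1)
  · push_cast
    have h2 : (1 : ℝ) ≤ 2 ^ k := one_le_pow₀ (by norm_num)
    have h3 : γ₀ * (1 / 2 ^ (k + 1)) < 1 := by
      rw [mul_one_div, div_lt_one (by positivity), pow_succ]
      linarith
    have h4 : 0 ≤ γ₀ * (1 / 2 ^ (k + 1)) := by positivity
    calc (γ₀ * (1 / 2 ^ (k + 1))) ^ 2 < 1 ^ 2 := pow_lt_pow_left₀ h3 h4 two_ne_zero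
      _ = 1 := one_pow 2

/-- The guard of the main branch: `1 ≤ K ≤ m`, `u ≥ 1`, and every element of the universe lies in
some set (otherwise the instance is decided outright; these are also the conditions under which
Khot's dimensions are polynomial in the code length). [folklore] -/
def Guard (I : SetCoverInstance) : Prop :=
  1 ≤ I.K ∧ I.K ≤ I.sets.length ∧ 1 ≤ I.univSize ∧ ∀ e < I.univSize, ∃ j < I.sets.length, e ∈ I.subsetAt j

/-- **Khot's instance from the coins** (main branch): the instance of `KhotAssembly.khotInstance`
for the explicit parameters of `KhotParameters` (`Q = D = T = ss^k (40K)^{k+1}`, `W = ss^k`,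
threshold `tauN`), the power-of-two modulus `q₂`, the data `Δ`, and the sample point decoded from
the coin string `c`. [cite: Khot2005, Thm. 5.1 and §7.3] -/
def khotMain (k : ℕ) (Δ : KhotData k) (u σ K : ℕ) (hu : 1 ≤ u) (F : Fin σ → Finset (Fin u)) (c : List Bool) :
    GapSVPInstance :=
  khotInstance (DD u σ K k : ℤ) F (Δ.P u σ K) (tupleShift (Δ.P u σ K) (coinDecode u σ K k c).1) (DD u σ K k : ℤ)
    (q₂ u σ K k) (⟨0, hu⟩ : Fin u) ((ss u σ K k ^ k : ℕ) : ℤ) k (DD u σ K k : ℤ) (tauN u σ K k : ℚ)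
    (Δ.eR u σ K) (Δ.eC u σ K hu) (coinDecode u σ K k c).2

open Classical in
/-- **The total output map of the reduction** on a set cover instance `I` and a coin string `c`:
Khot's instance on the guard, the fixed YES instance if the universe is empty and `1 ≤ K ≤ m`, the
fixed NO instance otherwise. [cite: Khot2005, §7.3] -/
def khotOutput (k : ℕ) (Δ : KhotData k) (I : SetCoverInstance) (c : List Bool) : GapSVPInstance :=
  if h : Guard I then khotMain k Δ I.univSize I.sets.length I.K h.2.2.1 (setSystem I) c
  else if I.univSize = 0 ∧ 1 ≤ I.K ∧ I.K ≤ I.sets.length then fixedYes else fixedNoPow k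

/-- Only the first `L₀` coins are read. [folklore] -/
theorem khotMain_take (k : ℕ) (Δ : KhotData k) (u σ K : ℕ) (hu : 1 ≤ u) (F : Fin σ → Finset (Fin u)) (c : List Bool) :
    khotMain k Δ u σ K hu F (c.take (L₀ u σ K k)) = khotMain k Δ u σ K hu F c := by
  unfold khotMain
  rw [coinDecode_take]

end OutputMap

/-! ### Probability bookkeeping -/

section Probability

open Params Classical

/-- The uniform probability of an event read off the first `L₀` coins does not depend on the number
`L ≥ L₀` of coins (`map_take_uniformOfFintype_vector`). [folklore] -/
theorem uniformProb_take {L₁ L : ℕ} (hL : L₁ ≤ L) (E : Set (List Bool)) :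
    uniformProb L {c | c.take L₁ ∈ E} = uniformProb L₁ E := by
  rw [uniformProb_eq_toOuterMeasure, uniformProb_eq_toOuterMeasure]
  have h1 : {r : List.Vector Bool L | r.toList ∈ {c : List Bool | c.take L₁ ∈ E}} =
      (fun r : List.Vector Bool L => r.toList.take L₁) ⁻¹' E := rfl
  have h2 : {r : List.Vector Bool L₁ | r.toList ∈ E} = List.Vector.toList ⁻¹' E := rfl
  rw [h1, h2, ← PMF.toOuterMeasure_map_apply, ← PMF.toOuterMeasure_map_apply, map_take_uniformOfFintype_vector hL]

/-- `uniformProb` as a counting fraction over `List.Vector`. [folklore] -/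
theorem uniformProb_eq_card (L : ℕ) (E : Set (List Bool)) :
    uniformProb L E = #((univ : Finset (List.Vector Bool L)).filter fun r => r.toList ∈ E) / 2 ^ L := by
  unfold uniformProb
  congr

/-- From a count of bad sample points to a probability bound: if `100 · #bad ≤ t · 2^{L}` then
the good event has probability `≥ 1 - t/100`. [folklore] -/
theorem uniformProb_ge_of_card_bad {L : ℕ} {good : List Bool → Prop} {t : ℕ}
    (h : 100 * #((univ : Finset (List.Vector Bool L)).filter fun r => ¬good r.toList) ≤ t * 2 ^ L) :
    1 - (t : ℝ) / 100 ≤ uniformProb L {c | good c} := by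
  rw [uniformProb_eq_card]
  have hsum := Finset.card_filter_add_card_filter_not (s := (univ : Finset (List.Vector Bool L)))
    (fun r => good r.toList)
  rw [Finset.card_univ, card_vector, Fintype.card_bool] at hsum
  have hpos : (0 : ℝ) < 2 ^ L := by positivity
  rw [le_div_iff₀ hpos]
  have h' : (100 : ℝ) * #((univ : Finset (List.Vector Bool L)).filter fun r => ¬good r.toList) ≤ t * 2 ^ L := by
    exact_mod_cast h
  have hsum' : (#((univ : Finset (List.Vector Bool L)).filter fun r => good r.toList) : ℝ) +
      #((univ : Finset (List.Vector Bool L)).filter fun r => ¬good r.toList) = 2 ^ L := by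
    exact_mod_cast hsum
  simp only [Set.mem_setOf_eq]
  nlinarith

/-- **YES side, main branch**: with probability `≥ 98/100 ≥ 2/3` over the coins (any number
`L ≥ L₀` of them) Khot's instance is a YES instance of `GapSVP_{γ₀}`. [cite: Khot2005, Thm. 5.1 (2) and §7.3] -/
theorem uniformProb_khotMain_yes {γ₀ : ℝ} (hγ₀ : 1 ≤ γ₀) {k : ℕ} (hk : 8 * γ₀ ^ 2 < (8 / 7 : ℝ) ^ k)
    (Δ : KhotData k) (u σ K : ℕ) (hu : 1 ≤ u) (hK : 1 ≤ K) (F : Fin σ → Finset (Fin u))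
    (hyes : ∃ T₀ : Finset (Fin σ), T₀.card = K ∧ ∀ e : Fin u, (T₀.filter fun j => e ∈ F j).card = 1)
    {L : ℕ} (hL : L₀ u σ K k ≤ L) :
    (2 / 3 : ℝ) ≤ uniformProb L {c | khotMain k Δ u σ K hu F c ∈ GapSVP.yes fun _ => γ₀} := by
  have hpre : {c | khotMain k Δ u σ K hu F c ∈ GapSVP.yes fun _ => γ₀} =
      {c | c.take (L₀ u σ K k) ∈ {c | khotMain k Δ u σ K hu F c ∈ GapSVP.yes fun _ => γ₀}} := by
    ext c; simp only [Set.mem_setOf_eq, khotMain_take]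
  rw [hpre, uniformProb_take hL]
  have hbad := ((khot_gap_instances₂ hγ₀ hk Δ u σ K hu hK F).1 hyes)
  rw [card_Ω, ← card_filter_coinDecode u σ K k] at hbad
  have h := uniformProb_ge_of_card_bad (L := L₀ u σ K k) (t := 2)
    (good := fun c => khotMain k Δ u σ K hu F c ∈ GapSVP.yes fun _ => γ₀) hbad
  norm_num at h
  exact le_trans (by norm_num) h

/-- **NO side, main branch**: with probability `≥ 99/100 ≥ 2/3` over the coins Khot's instance is a
NO instance of `GapSVP_{γ₀}`. [cite: Khot2005, Thm. 5.1 (3) and §7.3] -/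
theorem uniformProb_khotMain_no {γ₀ : ℝ} (hγ₀ : 1 ≤ γ₀) {k : ℕ} (hk : 8 * γ₀ ^ 2 < (8 / 7 : ℝ) ^ k)
    (Δ : KhotData k) (u σ K : ℕ) (hu : 1 ≤ u) (hK : 1 ≤ K) (F : Fin σ → Finset (Fin u))
    (hno : ∀ T₀ : Finset (Fin σ), T₀.card < 40 * K → ∃ e : Fin u, ∀ j ∈ T₀, e ∉ F j)
    {L : ℕ} (hL : L₀ u σ K k ≤ L) :
    (2 / 3 : ℝ) ≤ uniformProb L {c | khotMain k Δ u σ K hu F c ∈ GapSVP.no fun _ => γ₀} := by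
  have hpre : {c | khotMain k Δ u σ K hu F c ∈ GapSVP.no fun _ => γ₀} =
      {c | c.take (L₀ u σ K k) ∈ {c | khotMain k Δ u σ K hu F c ∈ GapSVP.no fun _ => γ₀}} := by
    ext c; simp only [Set.mem_setOf_eq, khotMain_take]
  rw [hpre, uniformProb_take hL]
  have hbad := ((khot_gap_instances₂ hγ₀ hk Δ u σ K hu hK F).2 hno)
  rw [card_Ω, ← card_filter_coinDecode u σ K k] at hbad
  have hbad' : 100 * #((univ : Finset (List.Vector Bool (L₀ u σ K k))).filter fun r =>
      ¬(khotMain k Δ u σ K hu F r.toList ∈ GapSVP.no fun _ => γ₀)) ≤ 1 * 2 ^ L₀ u σ K k := by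
    rw [one_mul]; exact hbad
  have h := uniformProb_ge_of_card_bad (L := L₀ u σ K k) (t := 1)
    (good := fun c => khotMain k Δ u σ K hu F c ∈ GapSVP.no fun _ => γ₀) hbad'
  norm_num at h
  exact le_trans (by norm_num) h

/-- **YES side of the reduction.** On a YES instance of `gapSetCover 40` (an exact cover of size
`K ≥ 1`), the output is a YES instance of `GapSVP_{γ₀}` with probability `≥ 2/3` over `L` coins,
for every `L` at least the number `L₀` of coins read. [cite: Khot2005, Thm. 1.1 and §7.3] -/
theorem uniformProb_khotOutput_yes {γ₀ : ℝ} (hγ₀ : 1 ≤ γ₀) {k : ℕ} (hk : 8 * γ₀ ^ 2 < (8 / 7 : ℝ) ^ k)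
    (Δ : KhotData k) {I : SetCoverInstance} (hI : I ∈ GapSetCover.yesSet) {L : ℕ}
    (hL : Guard I → L₀ I.univSize I.sets.length I.K k ≤ L) :
    (2 / 3 : ℝ) ≤ uniformProb L {c | khotOutput k Δ I c ∈ GapSVP.yes fun _ => γ₀} := by
  obtain ⟨hK0, T₀, hT₀K, hT₀ex⟩ := exactCover_of_mem_yesSet hI
  have hKm : I.K ≤ I.sets.length := by
    rw [← hT₀K]
    exact (Finset.card_le_univ T₀).trans (by rw [Fintype.card_fin])
  by_cases hu : 1 ≤ I.univSize
  · -- main branch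
    have hG : Guard I := by
      refine ⟨hK0, hKm, hu, fun e he => ?_⟩
      obtain ⟨j, hj⟩ := Finset.card_pos.1 (by rw [hT₀ex ⟨e, he⟩]; exact Nat.one_pos)
      rw [Finset.mem_filter, mem_setSystem] at hj
      exact ⟨j, j.isLt, hj.2⟩
    have hout : ∀ c, khotOutput k Δ I c = khotMain k Δ I.univSize I.sets.length I.K hu (setSystem I) c := fun c => by
      unfold khotOutput; rw [dif_pos hG]
    simp only [hout]
    exact uniformProb_khotMain_yes hγ₀ hk Δ _ _ _ hu hK0 (setSystem I) ⟨T₀, hT₀K, hT₀ex⟩ (hL hG)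
  · -- empty universe: the fixed YES instance
    have hout : ∀ c, khotOutput k Δ I c = fixedYes := fun c => by
      unfold khotOutput
      rw [dif_neg (fun hG => hu hG.2.2.1), if_pos ⟨by omega, hK0, hKm⟩]
    have huniv : {c : List Bool | khotOutput k Δ I c ∈ GapSVP.yes fun _ => γ₀} = Set.univ :=
      Set.eq_univ_of_forall fun c => by rw [Set.mem_setOf_eq, hout]; exact fixedYes_mem _
    rw [huniv, uniformProb_univ]
    norm_num

/-- **NO side of the reduction.** On a NO instance of `gapSetCover 40` (every cover has `≥ 40K`
sets), the output is a NO instance of `GapSVP_{γ₀}` with probability `≥ 2/3` over `L ≥ L₀` coins.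
[cite: Khot2005, Thm. 1.1 and §7.3] -/
theorem uniformProb_khotOutput_no {γ₀ : ℝ} (hγ₀ : 1 ≤ γ₀) {k : ℕ} (hk : 8 * γ₀ ^ 2 < (8 / 7 : ℝ) ^ k)
    (Δ : KhotData k) {I : SetCoverInstance} (hI : I ∈ GapSetCover.noSet 40) {L : ℕ}
    (hL : Guard I → L₀ I.univSize I.sets.length I.K k ≤ L) :
    (2 / 3 : ℝ) ≤ uniformProb L {c | khotOutput k Δ I c ∈ GapSVP.no fun _ => γ₀} := by
  by_cases hG : Guard I
  · -- main branch
    have hout : ∀ c, khotOutput k Δ I c = khotMain k Δ I.univSize I.sets.length I.K hG.2.2.1 (setSystem I) c :=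
      fun c => by unfold khotOutput; rw [dif_pos hG]
    simp only [hout]
    exact uniformProb_khotMain_no hγ₀ hk Δ _ _ _ hG.2.2.1 hG.1 (setSystem I) (noCover_of_mem_noSet hI) (hL hG)
  · -- decided outright: the fixed NO instance
    have hnot : ¬(I.univSize = 0 ∧ 1 ≤ I.K ∧ I.K ≤ I.sets.length) := fun h =>
      not_mem_noSet_of_univSize_eq_zero h.1 h.2.1 (by norm_num) hI
    have hout : ∀ c, khotOutput k Δ I c = fixedNoPow k := fun c => by
      unfold khotOutput; rw [dif_neg hG, if_neg hnot]
    have hγk : γ₀ < 2 ^ k := by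
      have h1 : (8 / 7 : ℝ) ^ k ≤ 2 ^ k := pow_le_pow_left₀ (by norm_num) (by norm_num) k
      have h2 : (2 : ℝ) ^ k ≤ 4 ^ k := pow_le_pow_left₀ (by norm_num) (by norm_num) k
      have h3 : (4 : ℝ) ^ k = (2 ^ k) ^ 2 := by rw [← pow_mul, pow_mul']; norm_num
      have h4 : γ₀ ^ 2 < (2 ^ k) ^ 2 := by nlinarith
      exact lt_of_pow_lt_pow_left₀ 2 (by positivity) h4
    have huniv : {c : List Bool | khotOutput k Δ I c ∈ GapSVP.no fun _ => γ₀} = Set.univ :=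
      Set.eq_univ_of_forall fun c => by
        rw [Set.mem_setOf_eq, hout]; exact fixedNoPow_mem (by linarith) hγk
    rw [huniv, uniformProb_univ]
    norm_num

end Probability

/-! ### The final assembly -/

section Final

open Params

/-- **Khot's randomised reduction from gap set cover to `GapSVP_{γ₀}`, given the machine.** For
`γ₀ ≥ 1`, `k` with `8γ₀² < (8/7)^k`, admissible data `Δ`, and an `FP` function `F` computing
`⟨code I, c⟩ ↦ code (khotOutput k Δ I c)` with a polynomial `Q` bounding the number `L₀` of coins
read on the guard, the algorithm `A(x; c) = F ⟨x, c⟩` with coin budget `Q` is a randomised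
polynomial-time reduction with two-sided error `≤ 1/3` from `gapSetCover 40` to `GapSVP_{γ₀}`
(`PromiseRandReducible`). [cite: Khot2005, Thm. 1.1, Thm. 5.1 and §7.3] -/
theorem promiseRandReducible_gapSetCover_gapSVP_of_FP {γ₀ : ℝ} (hγ₀ : 1 ≤ γ₀) {k : ℕ}
    (hk : 8 * γ₀ ^ 2 < (8 / 7 : ℝ) ^ k) (Δ : KhotData k) {F : List Bool → List Bool} (hF : F ∈ FP)
    {Q : Polynomial ℕ}
    (hQ : ∀ I : SetCoverInstance, Guard I → L₀ I.univSize I.sets.length I.K k ≤ Q.eval (SetCoverInstance.encoding.encode I).length)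
    (hFI : ∀ (I : SetCoverInstance) (c : List Bool),
      F (boolPair (SetCoverInstance.encoding.encode I) c) = GapSVPInstance.encode (khotOutput k Δ I c)) :
    PromiseRandReducible (gapSetCover 40) (gapSVPPromise fun _ => γ₀) := by
  let A : RandAlg (List Bool) (List Bool) := ⟨fun x c => F (boolPair x c), fun n => Q.eval n⟩
  refine ⟨A, ⟨PolyTimeComputable.of_encode_eq (f := F) (ea := id) (eb := id)
      (fun p : List Bool × List Bool => boolPair p.1 p.2) (fun _ => rfl) (fun _ => rfl) hF, Q, fun n => le_rfl⟩,
    ⟨Q, fun n => rfl⟩, ?_, ?_⟩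
  · rintro x ⟨I, hI, rfl⟩
    rw [RandAlg.pr_eq_uniformProb]
    convert uniformProb_khotOutput_yes hγ₀ hk Δ hI (fun hG => hQ I hG) using 2
    · rfl
    · ext c
      show F (boolPair (SetCoverInstance.encoding.encode I) c) ∈ GapSVP.yesLang (fun _ => γ₀) ↔
        khotOutput k Δ I c ∈ GapSVP.yes fun _ => γ₀
      rw [hFI, GapSVP.encode_mem_yesLang_iff]
  · rintro x ⟨I, hI, rfl⟩
    rw [RandAlg.pr_eq_uniformProb]
    convert uniformProb_khotOutput_no hγ₀ hk Δ hI (fun hG => hQ I hG) using 2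
    · rfl
    · ext c
      show F (boolPair (SetCoverInstance.encoding.encode I) c) ∈ GapSVP.noLang (fun _ => γ₀) ↔
        khotOutput k Δ I c ∈ GapSVP.no fun _ => γ₀
      rw [hFI, GapSVP.encode_mem_noLang_iff]

/-- **`gapSVP_const_isNPHardRandomized` from the PCP-based gap set cover hardness and the machine.**
The target named fact (`LatticeComplexity.lean`, pqc.S17: for every constant `γ₀ ≥ 1`, `GapSVP_{γ₀}`
is NP-hard under randomised polynomial-time many-one reductions with two-sided bounded error)
follows from (1) Arora–Babai–Stern–Sweedyk 1997, Prop. 6 (`AroraEtAl1997_prop6`, PCP-based, a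
named fact of `GapSetCover.lean`) and (2) the implementation statement that for every number of
levels `k` some `FP` function computes the total output map `khotOutput k Δ` on codes, for some
admissible data `Δ` (BCH matrices and output order, `nonempty_khotData`) and with a polynomial
bound on the coins read — Khot's "the reduction runs in time `n^{O(k²)}`" (§7.3) on the tree's
TM2 model, the one remaining (machine-level) obligation; everything mathematical and
probabilistic in Khot's Theorem 1.1 (`p = 2`) is proved in the tree. [cite: Khot2005, Thm. 1.1 and §7.3] -/
theorem gapSVP_const_isNPHardRandomized_of_prop6_of_FP (h₁ : AroraEtAl1997_prop6)
    (h₂ : ∀ k : ℕ, ∃ (Δ : KhotData k) (F : List Bool → List Bool) (Q : Polynomial ℕ), F ∈ FP ∧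
      (∀ I : SetCoverInstance, Guard I → L₀ I.univSize I.sets.length I.K k ≤ Q.eval (SetCoverInstance.encoding.encode I).length) ∧
      ∀ (I : SetCoverInstance) (c : List Bool),
        F (boolPair (SetCoverInstance.encoding.encode I) c) = GapSVPInstance.encode (khotOutput k Δ I c)) :
    gapSVP_const_isNPHardRandomized := by
  refine gapSVP_const_isNPHardRandomized_of_gapSetCover_forty h₁ fun γ₀ hγ₀ => ?_
  obtain ⟨k, hk⟩ := exists_levels γ₀
  obtain ⟨Δ, F, Q, hF, hQ, hFI⟩ := h₂ k
  exact promiseRandReducible_gapSetCover_gapSVP_of_FP hγ₀ hk Δ hF hQ hFI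

/-- The same, as randomised NP-hardness of each `GapSVP_{γ₀}` from the machine for ONE suitable `k`
(`8γ₀² < (8/7)^k`). [cite: Khot2005, Thm. 1.1 and §7.3] -/
theorem isNPHardRandomized_gapSVP_of_prop6_of_FP (h₁ : AroraEtAl1997_prop6) {γ₀ : ℝ} (hγ₀ : 1 ≤ γ₀)
    {k : ℕ} (hk : 8 * γ₀ ^ 2 < (8 / 7 : ℝ) ^ k) (Δ : KhotData k) {F : List Bool → List Bool} (hF : F ∈ FP)
    {Q : Polynomial ℕ}
    (hQ : ∀ I : SetCoverInstance, Guard I → L₀ I.univSize I.sets.length I.K k ≤ Q.eval (SetCoverInstance.encoding.encode I).length)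
    (hFI : ∀ (I : SetCoverInstance) (c : List Bool),
      F (boolPair (SetCoverInstance.encoding.encode I) c) = GapSVPInstance.encode (khotOutput k Δ I c)) :
    (gapSVPPromise fun _ => γ₀).IsNPHardRandomized :=
  isNPHardRandomized_gapSVP_of_gapSetCover h₁ (by norm_num)
    (promiseRandReducible_gapSetCover_gapSVP_of_FP hγ₀ hk Δ hF hQ hFI)

end Final

end Literature.Algebra.EuclideanLattices.Khot
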